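import Literature.Combinatorics.SimpleGraph.CycleSpaceSeparators
import Literature.Probability.LatticeModels.LatticeGraph
import HarnessLib

/-!
# The `★`-graph of `ℤ^d` and its cycle space: `★`-triangles generate (Friedli–Velenik, Lemma B.81)

Topic `Literature/Probability/LatticeModels`. The graph `ℤ^{d★}` on the lattice points of `ℤ^d`
in which two distinct points are adjacent iff they differ by at most `1` in every coordinate
(`‖x - y‖_∞ = 1`; Friedli–Velenik 2017, App. B.15: the `★`-edges `ℰ^★_{ℤ^d}`), the sup-distance
`supDist`, the `★`-triangles (three pairwise `★`-adjacent points), and the discrete Poincaré lemma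

> **Lemma B.81.** Every bounded `★`-cycle is a sum (mod 2) of `★`-triangles,

here in the sharper form needed for contour geometry inside boxes: an even set of `★`-edges whose
points lie in a coordinate box `∏[aᵢ, bᵢ]` is a sum of `★`-triangles *with vertices in that box*
(`inSpan_starTriangles_of_subset_Icc`, `generatesCycles_zdStar`). The proof is a layer-peeling
induction on `∑ᵢ (bᵢ - aᵢ)` (a variant of the algorithm of ibid.): at the top level `xᵢ = bᵢ` of
a direction `i` with `aᵢ < bᵢ`, a horizontal edge `uv` is traded, via the square `u v v↓ u↓`
(two triangles), for edges one level down; then the edges between the top level and the level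
below it, which come in even numbers at every top vertex, are removed two at a time through the
point `t↓` below their top vertex (one or two triangles); this empties the top level.

Everything is proved; no named facts.

## References

* S. Friedli, Y. Velenik, *Statistical Mechanics of Lattice Systems*, CUP 2017, App. B.15:
  `★`-edges, `★`-triangles, Lemma B.81. [FriedliVelenik2017]
-/

open Finset SimpleGraph
open Literature.Combinatorics.SimpleGraph.CycleSpace

namespace Literature.Probability.LatticeModels

variable {d : ℕ}

/-! ### Sup-distance and the `★`-graph -/

/-- The sup-distance `‖x - y‖_∞` of two lattice points, as a natural number.
[cite: FriedliVelenik2017, App. B.15 (d_∞)] -/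
def supDist (x y : Site d) : ℕ := Finset.univ.sup fun i => (x i - y i).natAbs

/-- `‖x - y‖_∞ ≤ n` coordinatewise. [cite: FriedliVelenik2017, App. B.15] -/
theorem supDist_le_iff {x y : Site d} {n : ℕ} : supDist x y ≤ n ↔ ∀ i, (x i - y i).natAbs ≤ n := by
  simp [supDist, Finset.sup_le_iff]

/-- Symmetry of the sup-distance. [folklore] -/
theorem supDist_comm (x y : Site d) : supDist x y = supDist y x := by
  unfold supDist
  congr 1
  funext i
  rw [← Int.natAbs_neg, neg_sub]

/-- `‖x - x‖_∞ = 0`. [folklore] -/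
@[simp] theorem supDist_self (x : Site d) : supDist x x = 0 := by
  simp [supDist]

/-- Points at sup-distance `0` are equal. [folklore] -/
theorem eq_of_supDist_eq_zero {x y : Site d} (h : supDist x y = 0) : x = y := by
  funext i
  have := (supDist_le_iff.1 h.le) i
  omega

/-- A coordinate bound from the sup-distance. [folklore] -/
theorem natAbs_sub_le_supDist (x y : Site d) (i : Fin d) : (x i - y i).natAbs ≤ supDist x y :=
  Finset.le_sup (f := fun i => (x i - y i).natAbs) (Finset.mem_univ i)

variable (d) in
/-- The `★`-graph `ℤ^{d★}`: distinct lattice points at sup-distance at most `1` are adjacent.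
[cite: FriedliVelenik2017, App. B.15 (ℰ^★_{ℤ^d})] -/
def zdStar : SimpleGraph (Site d) := SimpleGraph.fromRel fun x y => supDist x y ≤ 1

/-- Adjacency in `ℤ^{d★}`. [cite: FriedliVelenik2017, App. B.15] -/
theorem zdStar_adj {x y : Site d} : (zdStar d).Adj x y ↔ x ≠ y ∧ supDist x y ≤ 1 := by
  rw [zdStar, SimpleGraph.fromRel_adj, supDist_comm y x, or_self]

/-- Adjacency in `ℤ^{d★}` is decidable. [folklore] -/
instance : DecidableRel (zdStar d).Adj := fun x y =>
  decidable_of_iff (x ≠ y ∧ supDist x y ≤ 1) zdStar_adj.symm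

/-- Nearest neighbours are `★`-neighbours: `ℤ^d ≤ ℤ^{d★}`. [cite: FriedliVelenik2017, App. B.15] -/
theorem zdGraph_le_zdStar : zdGraph d ≤ zdStar d := by
  intro x y h
  refine zdStar_adj.2 ⟨h.ne, supDist_le_iff.2 fun j => ?_⟩
  obtain ⟨i, h | h⟩ := (zdGraph_adj_iff x y).1 h
  · rw [h, Pi.add_apply]
    by_cases hji : j = i
    · subst hji; rw [Pi.single_eq_same]; omega
    · rw [Pi.single_eq_of_ne hji]; omega
  · rw [h, Pi.add_apply]
    by_cases hji : j = i
    · subst hji; rw [Pi.single_eq_same]; omega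
    · rw [Pi.single_eq_of_ne hji]; omega

/-! ### `★`-triangles -/

/-- The family of `★`-triangles: the edge sets `{xy, yz, xz}` of three pairwise `★`-adjacent
points. [cite: FriedliVelenik2017, App. B.15 (★-triangles 𝒯)] -/
def starTriangles (d : ℕ) : Set (Finset (Sym2 (Site d))) :=
  {T | ∃ x y z : Site d, (zdStar d).Adj x y ∧ (zdStar d).Adj y z ∧ (zdStar d).Adj x z ∧
    T = {s(x, y), s(y, z), s(x, z)}}

/-- A `★`-triangle, as a member of the family. [cite: FriedliVelenik2017, App. B.15] -/
theorem triangle_mem_starTriangles {x y z : Site d} (hxy : (zdStar d).Adj x y) (hyz : (zdStar d).Adj y z)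
    (hxz : (zdStar d).Adj x z) : ({s(x, y), s(y, z), s(x, z)} : Finset (Sym2 (Site d))) ∈ starTriangles d :=
  ⟨x, y, z, hxy, hyz, hxz, rfl⟩

/-- `★`-triangles consist of `★`-edges. [cite: FriedliVelenik2017, App. B.15] -/
theorem mem_edgeSet_of_mem_starTriangles {T : Finset (Sym2 (Site d))} (hT : T ∈ starTriangles d)
    {e : Sym2 (Site d)} (he : e ∈ T) : e ∈ (zdStar d).edgeSet := by
  obtain ⟨x, y, z, hxy, hyz, hxz, rfl⟩ := hT
  simp only [Finset.mem_insert, Finset.mem_singleton] at he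
  rcases he with rfl | rfl | rfl
  · exact (mem_edgeSet (zdStar d)).2 hxy
  · exact (mem_edgeSet (zdStar d)).2 hyz
  · exact (mem_edgeSet (zdStar d)).2 hxz

/-- Degrees in a triangle `{xy, yz, xz}` on three distinct points: the sum of three indicators.
[folklore] -/
theorem edgeDeg_triangle {x y z : Site d} (hxy : x ≠ y) (hyz : y ≠ z) (hxz : x ≠ z) (v : Site d) :
    edgeDeg ({s(x, y), s(y, z), s(x, z)} : Finset (Sym2 (Site d))) v =
      (if v = x ∨ v = y then 1 else 0) + (if v = y ∨ v = z then 1 else 0) + (if v = x ∨ v = z then 1 else 0) := by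
  unfold edgeDeg
  rw [Finset.card_filter, Finset.sum_insert, Finset.sum_insert, Finset.sum_singleton]
  · simp only [Sym2.mem_iff]
    ring
  · simp [hyz, hxy.symm, hxz.symm]
  · simp [hxy, hyz, hxz, hxy.symm]

/-- The degree of a vertex in a `★`-triangle is `0` or `2`: triangles are even.
[cite: FriedliVelenik2017, App. B.15 (a ★-triangle is a cycle)] -/
theorem isEvenEdgeSet_of_mem_starTriangles {T : Finset (Sym2 (Site d))} (hT : T ∈ starTriangles d) :
    IsEvenEdgeSet T := by
  obtain ⟨x, y, z, hxy, hyz, hxz, rfl⟩ := hT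
  intro v
  rw [edgeDeg_triangle (zdStar_adj.1 hxy).1 (zdStar_adj.1 hyz).1 (zdStar_adj.1 hxz).1]
  have hxy' := (zdStar_adj.1 hxy).1; have hyz' := (zdStar_adj.1 hyz).1; have hxz' := (zdStar_adj.1 hxz).1
  by_cases hvx : v = x
  · subst hvx; simp [hxy', hxz']
  by_cases hvy : v = y
  · subst hvy; simp [hvx, hyz']
  by_cases hvz : v = z
  · subst hvz; simp [hvx, hvy]
  · simp [hvx, hvy, hvz]

/-! ### Lemma B.81: `★`-triangles generate the even `★`-edge sets

The proof peels the top level of a coordinate box; throughout, `i` is the peeling direction and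
`M = b i` the top level. -/

section B81

variable {d : ℕ}

/-- Two distinct points all of whose coordinates differ by at most one are `★`-adjacent.
[cite: FriedliVelenik2017, App. B.15] -/
theorem zdStar_adj_of_forall {x y : Site d} (hne : x ≠ y) (h : ∀ j, (x j - y j).natAbs ≤ 1) :
    (zdStar d).Adj x y :=
  zdStar_adj.2 ⟨hne, supDist_le_iff.2 h⟩

/-- Coordinates of `★`-adjacent points differ by at most one. [cite: FriedliVelenik2017, App. B.15] -/
theorem natAbs_sub_le_one_of_adj {x y : Site d} (h : (zdStar d).Adj x y) (j : Fin d) :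
    (x j - y j).natAbs ≤ 1 :=
  (supDist_le_iff.1 (zdStar_adj.1 h).2) j

/-- Lowering a point by one unit in direction `i` (`x↓ = x - eᵢ`). [folklore] -/
def siteDrop (i : Fin d) (x : Site d) : Site d := Function.update x i (x i - 1)

/-- The `i`-th coordinate of `x↓`. [folklore] -/
@[simp] theorem siteDrop_apply_same (i : Fin d) (x : Site d) : siteDrop i x i = x i - 1 := by
  simp [siteDrop]

/-- The other coordinates of `x↓`. [folklore] -/
theorem siteDrop_apply_of_ne {i j : Fin d} (h : j ≠ i) (x : Site d) : siteDrop i x j = x j := by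
  simp [siteDrop, h]

/-- `x↓ ≠ x`-type facts: a point whose `i`-th coordinate is `x i - 1` is not `x`. [folklore] -/
theorem ne_of_apply_eq_sub_one {i : Fin d} {x z : Site d} (hz : z i = x i - 1) : x ≠ z := by
  intro h; rw [h] at hz; omega

/-- `x ~ x↓`. [folklore] -/
theorem adj_siteDrop (i : Fin d) (x : Site d) : (zdStar d).Adj x (siteDrop i x) := by
  refine zdStar_adj_of_forall (ne_of_apply_eq_sub_one (siteDrop_apply_same i x)) (fun j => ?_)
  by_cases hj : j = i
  · subst hj; simp
  · rw [siteDrop_apply_of_ne hj]; simp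

/-- If `x ~ y` at the same `i`-level then `x ~ y↓`. [folklore] -/
theorem adj_siteDrop_of_adj {i : Fin d} {x y : Site d} (h : (zdStar d).Adj x y) (hxy : x i = y i) :
    (zdStar d).Adj x (siteDrop i y) := by
  refine zdStar_adj_of_forall (ne_of_apply_eq_sub_one (i := i) (by simp [hxy])) (fun j => ?_)
  by_cases hj : j = i
  · subst hj; simp [hxy]
  · rw [siteDrop_apply_of_ne hj]; exact natAbs_sub_le_one_of_adj h j

/-- Lowering both endpoints preserves adjacency. [folklore] -/
theorem adj_siteDrop_siteDrop {i : Fin d} {x y : Site d} (h : (zdStar d).Adj x y) :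
    (zdStar d).Adj (siteDrop i x) (siteDrop i y) := by
  refine zdStar_adj_of_forall (fun h' => (zdStar_adj.1 h).1 ?_) (fun j => ?_)
  · funext j
    have := congrFun h' j
    by_cases hj : j = i
    · subst hj; simp only [siteDrop_apply_same] at this; omega
    · rwa [siteDrop_apply_of_ne hj, siteDrop_apply_of_ne hj] at this
  · by_cases hj : j = i
    · subst hj
      simp only [siteDrop_apply_same]
      have := natAbs_sub_le_one_of_adj h j
      omega
    · rw [siteDrop_apply_of_ne hj, siteDrop_apply_of_ne hj]; exact natAbs_sub_le_one_of_adj h j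

/-- If `t ~ w` with `w` one level below `t` and `w ≠ t↓`, then `w ~ t↓`. [folklore] -/
theorem adj_siteDrop_of_adj_of_level {i : Fin d} {t w : Site d} (h : (zdStar d).Adj t w)
    (htw : w i = t i - 1) (hne : w ≠ siteDrop i t) : (zdStar d).Adj w (siteDrop i t) := by
  refine zdStar_adj_of_forall hne (fun j => ?_)
  by_cases hj : j = i
  · subst hj; simp [htw]
  · rw [siteDrop_apply_of_ne hj]; exact natAbs_sub_le_one_of_adj h.symm j

/-- Both endpoints at level `M` in direction `i` ("horizontal top edge"). [folklore] -/
def TopH (i : Fin d) (M : ℤ) (e : Sym2 (Site d)) : Prop :=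
  Sym2.lift ⟨fun x y => x i = M ∧ y i = M, fun _ _ => propext and_comm⟩ e

/-- `TopH` on a pair. [folklore] -/
@[simp] theorem topH_mk (i : Fin d) (M : ℤ) (x y : Site d) : TopH i M s(x, y) ↔ x i = M ∧ y i = M := Iff.rfl

/-- Some endpoint at level `M` in direction `i` ("touches the top level"). [folklore] -/
def Touch (i : Fin d) (M : ℤ) (e : Sym2 (Site d)) : Prop :=
  Sym2.lift ⟨fun x y => x i = M ∨ y i = M, fun _ _ => propext or_comm⟩ e

/-- `Touch` on a pair. [folklore] -/
@[simp] theorem touch_mk (i : Fin d) (M : ℤ) (x y : Site d) : Touch i M s(x, y) ↔ x i = M ∨ y i = M := Iff.rfl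

/-- `TopH` is decidable. [folklore] -/
instance (i : Fin d) (M : ℤ) : DecidablePred (TopH (d := d) i M) := fun e =>
  Quot.recOnSubsingleton (motive := fun e => Decidable (TopH i M e)) e fun ⟨x, y⟩ =>
    inferInstanceAs (Decidable (x i = M ∧ y i = M))

/-- `Touch` is decidable. [folklore] -/
instance (i : Fin d) (M : ℤ) : DecidablePred (Touch (d := d) i M) := fun e =>
  Quot.recOnSubsingleton (motive := fun e => Decidable (Touch i M e)) e fun ⟨x, y⟩ =>
    inferInstanceAs (Decidable (x i = M ∨ y i = M))

/-- The invariant of the peeling induction: `★`-edges, even, all endpoints in the box `∏ⱼ [a j, b j]`.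
[cite: FriedliVelenik2017, App. B.15, proof of Lemma B.81] -/
structure PeelInv (a b : Site d) (Z : Finset (Sym2 (Site d))) : Prop where
  edge : ∀ e ∈ Z, e ∈ (zdStar d).edgeSet
  even : IsEvenEdgeSet Z
  box : ∀ e ∈ Z, ∀ x ∈ e, ∀ j, a j ≤ x j ∧ x j ≤ b j

/-- Membership in an explicit triangle. [folklore] -/
theorem mem_triangle_iff {x y z : Site d} {e : Sym2 (Site d)} :
    e ∈ ({s(x, y), s(y, z), s(x, z)} : Finset (Sym2 (Site d))) ↔ e = s(x, y) ∨ e = s(y, z) ∨ e = s(x, z) := by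
  simp only [Finset.mem_insert, Finset.mem_singleton]

/-- Adding a `★`-triangle with vertices in the box preserves the invariant. [folklore] -/
theorem PeelInv.symmDiff_triangle {a b : Site d} {Z : Finset (Sym2 (Site d))} (hZ : PeelInv a b Z)
    {x y z : Site d} (hxy : (zdStar d).Adj x y) (hyz : (zdStar d).Adj y z) (hxz : (zdStar d).Adj x z)
    (hx : ∀ j, a j ≤ x j ∧ x j ≤ b j) (hy : ∀ j, a j ≤ y j ∧ y j ≤ b j) (hz : ∀ j, a j ≤ z j ∧ z j ≤ b j) :
    PeelInv a b (symmDiff {s(x, y), s(y, z), s(x, z)} Z) := by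
  refine ⟨fun e he => ?_, isEvenEdgeSet_symmDiff (isEvenEdgeSet_of_mem_starTriangles
    (triangle_mem_starTriangles hxy hyz hxz)) hZ.even, fun e he => ?_⟩
  · rcases (Finset.mem_symmDiff.1 he) with ⟨h, -⟩ | ⟨h, -⟩
    · exact mem_edgeSet_of_mem_starTriangles (triangle_mem_starTriangles hxy hyz hxz) h
    · exact hZ.edge e h
  · rcases (Finset.mem_symmDiff.1 he) with ⟨h, -⟩ | ⟨h, -⟩
    · rcases mem_triangle_iff.1 h with rfl | rfl | rfl
      · intro w hw; rcases Sym2.mem_iff.1 hw with rfl | rfl <;> assumption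
      · intro w hw; rcases Sym2.mem_iff.1 hw with rfl | rfl <;> assumption
      · intro w hw; rcases Sym2.mem_iff.1 hw with rfl | rfl <;> assumption
    · exact hZ.box e h

/-- Undoing a triangle step: if `T ∆ Z` is generated then so is `Z`. [folklore] -/
theorem inSpan_of_inSpan_symmDiff {𝒞 : Set (Finset (Sym2 (Site d)))} {T Z : Finset (Sym2 (Site d))}
    (hT : T ∈ 𝒞) (h : InSpan 𝒞 (symmDiff T Z)) : InSpan 𝒞 Z := by
  have := InSpan.step hT h
  rwa [symmDiff_symmDiff_cancel_left] at this

/-- The box membership of a lowered point at the top level. [folklore] -/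
theorem box_siteDrop {a b : Site d} {i : Fin d} (hab : a i < b i) {x : Site d}
    (hx : ∀ j, a j ≤ x j ∧ x j ≤ b j) (hxi : x i = b i) : ∀ j, a j ≤ siteDrop i x j ∧ siteDrop i x j ≤ b j := by
  intro j
  by_cases hj : j = i
  · subst hj; simp only [siteDrop_apply_same]; omega
  · rw [siteDrop_apply_of_ne hj]; exact hx j

/-- **Phase 1 step.** A horizontal top edge `uv` is traded, through the two triangles `u v v↓` and
`u v↓ u↓` (whose sum is the square `u v v↓ u↓`), for edges strictly below the top level.
[cite: FriedliVelenik2017, App. B.15, proof of Lemma B.81] -/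
theorem phase1_step {a b : Site d} {i : Fin d} (hab : a i < b i) {Z : Finset (Sym2 (Site d))} (hZ : PeelInv a b Z)
    (hpos : 0 < #(Z.filter (TopH i (b i)))) :
    ∃ Z', PeelInv a b Z' ∧ #(Z'.filter (TopH i (b i))) + 1 = #(Z.filter (TopH i (b i))) ∧
      (InSpan (starTriangles d) Z' → InSpan (starTriangles d) Z) := by
  obtain ⟨e, he⟩ := Finset.card_pos.1 hpos
  revert he
  induction e using Sym2.ind with
  | h u v =>
    intro he
    rw [Finset.mem_filter, topH_mk] at he
    obtain ⟨huvZ, hui, hvi⟩ := he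
    set M := b i
    have hadj : (zdStar d).Adj u v := hZ.edge _ huvZ
    have hu : ∀ j, a j ≤ u j ∧ u j ≤ b j := hZ.box _ huvZ u (Sym2.mem_mk_left u v)
    have hv : ∀ j, a j ≤ v j ∧ v j ≤ b j := hZ.box _ huvZ v (Sym2.mem_mk_right u v)
    set u' := siteDrop i u with hu'
    set v' := siteDrop i v with hv'
    have hu'i : u' i = M - 1 := by rw [hu', siteDrop_apply_same, hui]
    have hv'i : v' i = M - 1 := by rw [hv', siteDrop_apply_same, hvi]
    -- the two triangles
    have h1xy : (zdStar d).Adj u v := hadj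
    have h1yz : (zdStar d).Adj v v' := adj_siteDrop i v
    have h1xz : (zdStar d).Adj u v' := adj_siteDrop_of_adj hadj (by rw [hui, hvi])
    have h2xy : (zdStar d).Adj u v' := h1xz
    have h2yz : (zdStar d).Adj v' u' := (adj_siteDrop_siteDrop hadj).symm
    have h2xz : (zdStar d).Adj u u' := adj_siteDrop i u
    set T₁ : Finset (Sym2 (Site d)) := {s(u, v), s(v, v'), s(u, v')}
    set T₂ : Finset (Sym2 (Site d)) := {s(u, v'), s(v', u'), s(u, u')}
    refine ⟨symmDiff T₁ (symmDiff T₂ Z), ?_, ?_, fun h => ?_⟩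
    · exact (hZ.symmDiff_triangle h2xy h2yz h2xz hu (box_siteDrop hab hv hvi) (box_siteDrop hab hu hui)).symmDiff_triangle
        h1xy h1yz h1xz hu hv (box_siteDrop hab hv hvi)
    · -- the horizontal top edges: exactly `uv` is removed
      have hT₁ : ∀ e, TopH i M e → (e ∈ T₁ ↔ e = s(u, v)) := by
        intro e he
        refine ⟨fun h => ?_, fun h => by rw [h]; simp [T₁]⟩
        rcases mem_triangle_iff.1 h with h | h | h
        · exact h
        · rw [h, topH_mk] at he; omega
        · rw [h, topH_mk] at he; omega
      have hT₂ : ∀ e, TopH i M e → e ∉ T₂ := by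
        intro e he h
        rcases mem_triangle_iff.1 h with h | h | h <;> rw [h, topH_mk] at he <;> omega
      have hset : (symmDiff T₁ (symmDiff T₂ Z)).filter (TopH i M) = (Z.filter (TopH i M)).erase s(u, v) := by
        ext e
        simp only [Finset.mem_filter, Finset.mem_erase, Finset.mem_symmDiff]
        by_cases he : TopH i M e
        · have h2 := hT₂ e he
          by_cases heq : e = s(u, v)
          · subst heq
            have h1 : s(u, v) ∈ T₁ := (hT₁ _ he).2 rfl
            simp [h1, h2, huvZ, he]
          · have h1 : e ∉ T₁ := fun h' => heq ((hT₁ e he).1 h')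
            simp [h1, h2, he, heq]
        · simp [he]
      rw [hset, Finset.card_erase_of_mem (Finset.mem_filter.2 ⟨huvZ, hui, hvi⟩)]
      omega
    · exact inSpan_of_inSpan_symmDiff (triangle_mem_starTriangles h2xy h2yz h2xz)
        (inSpan_of_inSpan_symmDiff (triangle_mem_starTriangles h1xy h1yz h1xz) h)

/-- **Phase 1.** All horizontal top edges can be removed. [cite: FriedliVelenik2017, App. B.15, Lemma B.81] -/
theorem phase1 {a b : Site d} {i : Fin d} (hab : a i < b i) :
    ∀ (n : ℕ) (Z : Finset (Sym2 (Site d))), PeelInv a b Z → #(Z.filter (TopH i (b i))) = n →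
      ∃ Z', PeelInv a b Z' ∧ #(Z'.filter (TopH i (b i))) = 0 ∧
        (InSpan (starTriangles d) Z' → InSpan (starTriangles d) Z)
  | 0, Z, hZ, h => ⟨Z, hZ, h, id⟩
  | n + 1, Z, hZ, h => by
    obtain ⟨Z₁, hZ₁, hc, hs⟩ := phase1_step hab hZ (by omega)
    obtain ⟨Z', hZ', h0, hs'⟩ := phase1 hab n Z₁ hZ₁ (by omega)
    exact ⟨Z', hZ', h0, fun h => hs (hs' h)⟩

/-- Bookkeeping for a Phase 2 step: if the new edge set agrees with the old one on top-touching
edges except that the two edges `tw₁`, `tw₂` are removed, the counts behave as claimed. [folklore] -/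
theorem phase2_counts {i : Fin d} {M : ℤ} {Z Z' : Finset (Sym2 (Site d))} {t w₁ w₂ : Site d}
    (h₁ : s(t, w₁) ∈ Z) (h₂ : s(t, w₂) ∈ Z) (hti : t i = M) (hne : s(t, w₁) ≠ s(t, w₂))
    (htouch : ∀ e, Touch i M e → (e ∈ Z' ↔ e ∈ Z ∧ e ≠ s(t, w₁) ∧ e ≠ s(t, w₂)))
    (htop : ∀ e, TopH i M e → (e ∈ Z' ↔ e ∈ Z)) :
    #(Z'.filter (TopH i M)) = #(Z.filter (TopH i M)) ∧
      #(Z'.filter (Touch i M)) + 2 = #(Z.filter (Touch i M)) := by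
  constructor
  · congr 1
    ext e
    simp only [Finset.mem_filter]
    exact ⟨fun ⟨h, he⟩ => ⟨(htop e he).1 h, he⟩, fun ⟨h, he⟩ => ⟨(htop e he).2 h, he⟩⟩
  · have hset : Z'.filter (Touch i M) = ((Z.filter (Touch i M)).erase s(t, w₁)).erase s(t, w₂) := by
      ext e
      simp only [Finset.mem_filter, Finset.mem_erase]
      constructor
      · rintro ⟨h, he⟩
        obtain ⟨hz, h1, h2⟩ := (htouch e he).1 h
        exact ⟨h2, h1, hz, he⟩
      · rintro ⟨h2, h1, hz, he⟩
        exact ⟨(htouch e he).2 ⟨hz, h1, h2⟩, he⟩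
    have hm₁ : s(t, w₁) ∈ Z.filter (Touch i M) := Finset.mem_filter.2 ⟨h₁, Or.inl hti⟩
    have hm₂ : s(t, w₂) ∈ (Z.filter (Touch i M)).erase s(t, w₁) := Finset.mem_erase.2 ⟨hne.symm, Finset.mem_filter.2 ⟨h₂, Or.inl hti⟩⟩
    rw [hset, Finset.card_erase_of_mem hm₂, Finset.card_erase_of_mem hm₁]
    have : 2 ≤ #(Z.filter (Touch i M)) := by
      have h1 := Finset.card_pos.2 ⟨_, hm₂⟩
      rw [Finset.card_erase_of_mem hm₁] at h1
      omega
    omega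

/-- **Phase 2 step, degenerate case.** Top vertex `t`, lower neighbours `w₁ = t↓`-like and `w₂`
with `w₁ ~ w₂`: the single triangle `t w₂ w₁` removes `tw₁`, `tw₂`.
[cite: FriedliVelenik2017, App. B.15, proof of Lemma B.81] -/
theorem phase2_step_one {a b : Site d} {i : Fin d} {Z : Finset (Sym2 (Site d))} (hZ : PeelInv a b Z)
    {t w₁ w₂ : Site d} (h₁ : s(t, w₁) ∈ Z) (h₂ : s(t, w₂) ∈ Z) (hti : t i = b i)
    (hw₁ : w₁ i = b i - 1) (hw₂ : w₂ i = b i - 1) (hne : w₁ ≠ w₂) (hyz : (zdStar d).Adj w₂ w₁) :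
    ∃ Z', PeelInv a b Z' ∧ #(Z'.filter (TopH i (b i))) = #(Z.filter (TopH i (b i))) ∧
      #(Z'.filter (Touch i (b i))) + 2 = #(Z.filter (Touch i (b i))) ∧
      (InSpan (starTriangles d) Z' → InSpan (starTriangles d) Z) := by
  set M := b i
  have ht : ∀ j, a j ≤ t j ∧ t j ≤ b j := hZ.box _ h₁ t (Sym2.mem_mk_left t w₁)
  have hb₁ : ∀ j, a j ≤ w₁ j ∧ w₁ j ≤ b j := hZ.box _ h₁ w₁ (Sym2.mem_mk_right t w₁)
  have hb₂ : ∀ j, a j ≤ w₂ j ∧ w₂ j ≤ b j := hZ.box _ h₂ w₂ (Sym2.mem_mk_right t w₂)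
  have hxy : (zdStar d).Adj t w₂ := hZ.edge _ h₂
  have hxz : (zdStar d).Adj t w₁ := hZ.edge _ h₁
  set T : Finset (Sym2 (Site d)) := {s(t, w₂), s(w₂, w₁), s(t, w₁)}
  have hsne : s(t, w₁) ≠ s(t, w₂) := by
    rw [Ne, Sym2.eq_iff]
    rintro (⟨-, h⟩ | ⟨h, -⟩)
    · exact hne h
    · rw [h] at hti; omega
  refine ⟨symmDiff T Z, hZ.symmDiff_triangle hxy hyz hxz ht hb₂ hb₁, ?_⟩
  have hmemT : ∀ e, Touch i M e → (e ∈ T ↔ e = s(t, w₂) ∨ e = s(t, w₁)) := by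
    intro e he
    rw [mem_triangle_iff]
    constructor
    · rintro (h | h | h)
      · exact Or.inl h
      · rw [h, touch_mk] at he; omega
      · exact Or.inr h
    · rintro (h | h)
      · exact Or.inl h
      · exact Or.inr (Or.inr h)
  have htopT : ∀ e, TopH i M e → e ∉ T := by
    intro e he h
    rcases mem_triangle_iff.1 h with h | h | h <;> rw [h, topH_mk] at he <;> omega
  obtain ⟨hc1, hc2⟩ := phase2_counts (Z' := symmDiff T Z) h₁ h₂ hti hsne
    (fun e he => by
      rw [Finset.mem_symmDiff]
      by_cases he1 : e = s(t, w₁)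
      · subst he1
        have hT : s(t, w₁) ∈ T := (hmemT _ he).2 (Or.inr rfl)
        simp [hT, h₁]
      by_cases he2 : e = s(t, w₂)
      · subst he2
        have hT : s(t, w₂) ∈ T := (hmemT _ he).2 (Or.inl rfl)
        simp [hT, h₂]
      have hT : e ∉ T := fun h => by rcases (hmemT e he).1 h with h | h <;> contradiction
      simp [hT, he1, he2])
    (fun e he => by rw [Finset.mem_symmDiff]; simp [htopT e he])
  exact ⟨hc1, hc2, inSpan_of_inSpan_symmDiff (triangle_mem_starTriangles hxy hyz hxz)⟩

/-- **Phase 2 step, generic case.** Top vertex `t`, distinct lower neighbours `w₁, w₂ ≠ t↓`: the two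
triangles `t w₁ t↓`, `t w₂ t↓` (whose sum is `t w₁, w₁ t↓, t↓ w₂, w₂ t`) remove `tw₁`, `tw₂`.
[cite: FriedliVelenik2017, App. B.15, proof of Lemma B.81] -/
theorem phase2_step_two {a b : Site d} {i : Fin d} (hab : a i < b i) {Z : Finset (Sym2 (Site d))} (hZ : PeelInv a b Z)
    {t w₁ w₂ : Site d} (h₁ : s(t, w₁) ∈ Z) (h₂ : s(t, w₂) ∈ Z) (hti : t i = b i)
    (hw₁ : w₁ i = b i - 1) (hw₂ : w₂ i = b i - 1) (hne : w₁ ≠ w₂)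
    (hd₁ : w₁ ≠ siteDrop i t) (hd₂ : w₂ ≠ siteDrop i t) :
    ∃ Z', PeelInv a b Z' ∧ #(Z'.filter (TopH i (b i))) = #(Z.filter (TopH i (b i))) ∧
      #(Z'.filter (Touch i (b i))) + 2 = #(Z.filter (Touch i (b i))) ∧
      (InSpan (starTriangles d) Z' → InSpan (starTriangles d) Z) := by
  set M := b i
  set t' := siteDrop i t with ht'def
  have ht'i : t' i = M - 1 := by rw [ht'def, siteDrop_apply_same, hti]
  have ht : ∀ j, a j ≤ t j ∧ t j ≤ b j := hZ.box _ h₁ t (Sym2.mem_mk_left t w₁)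
  have hb₁ : ∀ j, a j ≤ w₁ j ∧ w₁ j ≤ b j := hZ.box _ h₁ w₁ (Sym2.mem_mk_right t w₁)
  have hb₂ : ∀ j, a j ≤ w₂ j ∧ w₂ j ≤ b j := hZ.box _ h₂ w₂ (Sym2.mem_mk_right t w₂)
  have hbt' : ∀ j, a j ≤ t' j ∧ t' j ≤ b j := box_siteDrop hab ht hti
  have ha₁ : (zdStar d).Adj t w₁ := hZ.edge _ h₁
  have ha₂ : (zdStar d).Adj t w₂ := hZ.edge _ h₂
  have hat : (zdStar d).Adj t t' := adj_siteDrop i t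
  have ha₁' : (zdStar d).Adj w₁ t' := adj_siteDrop_of_adj_of_level ha₁ (by rw [hw₁, hti]) hd₁
  have ha₂' : (zdStar d).Adj w₂ t' := adj_siteDrop_of_adj_of_level ha₂ (by rw [hw₂, hti]) hd₂
  set T₁ : Finset (Sym2 (Site d)) := {s(t, w₁), s(w₁, t'), s(t, t')}
  set T₂ : Finset (Sym2 (Site d)) := {s(t, w₂), s(w₂, t'), s(t, t')}
  have hsne : s(t, w₁) ≠ s(t, w₂) := by
    rw [Ne, Sym2.eq_iff]
    rintro (⟨-, h⟩ | ⟨h, -⟩)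
    · exact hne h
    · rw [h] at hti; omega
  refine ⟨symmDiff T₁ (symmDiff T₂ Z),
    (hZ.symmDiff_triangle ha₂ ha₂' hat ht hb₂ hbt').symmDiff_triangle ha₁ ha₁' hat ht hb₁ hbt', ?_⟩
  -- membership of top-touching pairs in the two triangles
  have hmem₁ : ∀ e, Touch i M e → (e ∈ T₁ ↔ e = s(t, w₁) ∨ e = s(t, t')) := by
    intro e he
    rw [mem_triangle_iff]
    constructor
    · rintro (h | h | h)
      · exact Or.inl h
      · rw [h, touch_mk] at he; omega
      · exact Or.inr h
    · rintro (h | h)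
      · exact Or.inl h
      · exact Or.inr (Or.inr h)
  have hmem₂ : ∀ e, Touch i M e → (e ∈ T₂ ↔ e = s(t, w₂) ∨ e = s(t, t')) := by
    intro e he
    rw [mem_triangle_iff]
    constructor
    · rintro (h | h | h)
      · exact Or.inl h
      · rw [h, touch_mk] at he; omega
      · exact Or.inr h
    · rintro (h | h)
      · exact Or.inl h
      · exact Or.inr (Or.inr h)
  have htop₁ : ∀ e, TopH i M e → e ∉ T₁ := by
    intro e he h
    rcases mem_triangle_iff.1 h with h | h | h <;> rw [h, topH_mk] at he <;> omega
  have htop₂ : ∀ e, TopH i M e → e ∉ T₂ := by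
    intro e he h
    rcases mem_triangle_iff.1 h with h | h | h <;> rw [h, topH_mk] at he <;> omega
  -- the three distinguished pairs are pairwise distinct
  have hn1 : s(t, w₁) ≠ s(t, t') := by
    rw [Ne, Sym2.eq_iff]
    rintro (⟨-, h⟩ | ⟨h, -⟩)
    · exact hd₁ h
    · rw [h] at hti; omega
  have hn2 : s(t, w₂) ≠ s(t, t') := by
    rw [Ne, Sym2.eq_iff]
    rintro (⟨-, h⟩ | ⟨h, -⟩)
    · exact hd₂ h
    · rw [h] at hti; omega
  obtain ⟨hc1, hc2⟩ := phase2_counts (Z' := symmDiff T₁ (symmDiff T₂ Z)) h₁ h₂ hti hsne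
    (fun e he => by
      rw [Finset.mem_symmDiff, Finset.mem_symmDiff]
      have hm1 := hmem₁ e he
      have hm2 := hmem₂ e he
      by_cases he1 : e = s(t, w₁)
      · subst he1
        have h3 : s(t, w₁) ∈ T₁ := hm1.2 (Or.inl rfl)
        have h4 : s(t, w₁) ∉ T₂ := fun h => by rcases hm2.1 h with h | h <;> contradiction
        simp [h3, h4, h₁]
      by_cases he2 : e = s(t, w₂)
      · subst he2
        have h3 : s(t, w₂) ∉ T₁ := fun h => by rcases hm1.1 h with h | h <;> contradiction
        have h4 : s(t, w₂) ∈ T₂ := hm2.2 (Or.inl rfl)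
        simp [h3, h4, h₂]
      by_cases he3 : e = s(t, t')
      · subst he3
        have h3 : s(t, t') ∈ T₁ := hm1.2 (Or.inr rfl)
        have h4 : s(t, t') ∈ T₂ := hm2.2 (Or.inr rfl)
        simp [h3, h4, he1, he2]
      have h3 : e ∉ T₁ := fun h => by rcases hm1.1 h with h | h <;> contradiction
      have h4 : e ∉ T₂ := fun h => by rcases hm2.1 h with h | h <;> contradiction
      simp [h3, h4, he1, he2])
    (fun e he => by
      rw [Finset.mem_symmDiff, Finset.mem_symmDiff]
      simp [htop₁ e he, htop₂ e he])
  exact ⟨hc1, hc2, fun h => inSpan_of_inSpan_symmDiff (triangle_mem_starTriangles ha₂ ha₂' hat)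
    (inSpan_of_inSpan_symmDiff (triangle_mem_starTriangles ha₁ ha₁' hat) h)⟩

/-- **Phase 2 step.** With no horizontal top edge left, an edge touching the top level hangs from a
top vertex `t` to the level below; by evenness a second such edge hangs from `t`, and the pair is
removed by one or two triangles through `t↓`. [cite: FriedliVelenik2017, App. B.15, Lemma B.81] -/
theorem phase2_step {a b : Site d} {i : Fin d} (hab : a i < b i) {Z : Finset (Sym2 (Site d))} (hZ : PeelInv a b Z)
    (h0 : #(Z.filter (TopH i (b i))) = 0) (hpos : 0 < #(Z.filter (Touch i (b i)))) :
    ∃ Z', PeelInv a b Z' ∧ #(Z'.filter (TopH i (b i))) = 0 ∧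
      #(Z'.filter (Touch i (b i))) + 2 = #(Z.filter (Touch i (b i))) ∧
      (InSpan (starTriangles d) Z' → InSpan (starTriangles d) Z) := by
  set M := b i
  have hnoTop : ∀ e ∈ Z, ¬ TopH i M e := fun e he ht =>
    Finset.card_ne_zero.2 ⟨e, Finset.mem_filter.2 ⟨he, ht⟩⟩ h0
  -- an edge `tw` with `t` on top
  obtain ⟨t, w, htw, hti⟩ : ∃ t w, s(t, w) ∈ Z ∧ t i = M := by
    obtain ⟨e, he⟩ := Finset.card_pos.1 hpos
    revert he
    induction e using Sym2.ind with
    | h x y =>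
      intro he
      rw [Finset.mem_filter, touch_mk] at he
      rcases he.2 with h | h
      · exact ⟨x, y, he.1, h⟩
      · exact ⟨y, x, by rw [Sym2.eq_swap]; exact he.1, h⟩
  -- the lower endpoint of any edge at `t` is one level down
  have hlow : ∀ w, s(t, w) ∈ Z → w i = M - 1 := by
    intro w hw
    have hadj : (zdStar d).Adj t w := hZ.edge _ hw
    have h1 := natAbs_sub_le_one_of_adj hadj i
    have h2 := (hZ.box _ hw w (Sym2.mem_mk_right t w) i).2
    have h3 : ¬ (t i = M ∧ w i = M) := hnoTop _ hw
    omega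
  -- a second edge at `t`
  obtain ⟨w', htw', hww'⟩ : ∃ w', s(t, w') ∈ Z ∧ w' ≠ w := by
    have heven := hZ.even t
    have hmem : s(t, w) ∈ Z.filter (t ∈ ·) := Finset.mem_filter.2 ⟨htw, Sym2.mem_mk_left t w⟩
    have h2 : 1 < edgeDeg Z t := by
      unfold edgeDeg at heven ⊢
      have h1 : 0 < #(Z.filter (t ∈ ·)) := Finset.card_pos.2 ⟨_, hmem⟩
      obtain ⟨k, hk⟩ := heven
      omega
    obtain ⟨e', he', hne⟩ := Finset.exists_mem_ne h2 s(t, w)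
    rw [Finset.mem_filter] at he'
    refine ⟨Sym2.Mem.other he'.2, ?_, fun h => hne ?_⟩
    · rw [Sym2.other_spec he'.2]; exact he'.1
    · rw [← Sym2.other_spec he'.2, h]
  have hwi := hlow w htw
  have hw'i := hlow w' htw'
  by_cases hd : w = siteDrop i t
  · -- `w = t↓`: one triangle `t w' w`
    have hd' : w' ≠ siteDrop i t := fun h => hww' (h.trans hd.symm)
    have ha' : (zdStar d).Adj t w' := hZ.edge _ htw'
    have hadj : (zdStar d).Adj w' w := by
      rw [hd]; exact adj_siteDrop_of_adj_of_level ha' (by rw [hw'i, hti]) hd'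
    obtain ⟨Z', hZ', hc1, hc2, hs⟩ := phase2_step_one hZ htw htw' hti hwi hw'i hww'.symm hadj
    exact ⟨Z', hZ', hc1.trans h0, hc2, hs⟩
  by_cases hd' : w' = siteDrop i t
  · -- `w' = t↓`: one triangle `t w w'`
    have ha : (zdStar d).Adj t w := hZ.edge _ htw
    have hadj : (zdStar d).Adj w w' := by
      rw [hd']; exact adj_siteDrop_of_adj_of_level ha (by rw [hwi, hti]) hd
    obtain ⟨Z', hZ', hc1, hc2, hs⟩ := phase2_step_one hZ htw' htw hti hw'i hwi hww' hadj
    exact ⟨Z', hZ', hc1.trans h0, by rw [hc2], hs⟩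
  · obtain ⟨Z', hZ', hc1, hc2, hs⟩ := phase2_step_two hab hZ htw htw' hti hwi hw'i hww'.symm hd hd'
    exact ⟨Z', hZ', hc1.trans h0, hc2, hs⟩

/-- **Phase 2.** With no horizontal top edge, all edges touching the top level can be removed.
[cite: FriedliVelenik2017, App. B.15, Lemma B.81] -/
theorem phase2 {a b : Site d} {i : Fin d} (hab : a i < b i) (n : ℕ) :
    ∀ (Z : Finset (Sym2 (Site d))), PeelInv a b Z → #(Z.filter (TopH i (b i))) = 0 →
      #(Z.filter (Touch i (b i))) ≤ n →
      ∃ Z', PeelInv a b Z' ∧ #(Z'.filter (Touch i (b i))) = 0 ∧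
        (InSpan (starTriangles d) Z' → InSpan (starTriangles d) Z) := by
  induction n with
  | zero => exact fun Z hZ _ h => ⟨Z, hZ, by omega, id⟩
  | succ n ih =>
    intro Z hZ h0 hn
    by_cases hpos : #(Z.filter (Touch i (b i))) = 0
    · exact ⟨Z, hZ, hpos, id⟩
    obtain ⟨Z₁, hZ₁, h0₁, hc, hs⟩ := phase2_step hab hZ h0 (by omega)
    obtain ⟨Z', hZ', h0', hs'⟩ := ih Z₁ hZ₁ h0₁ (by omega)
    exact ⟨Z', hZ', h0', fun h => hs (hs' h)⟩

/-- **Lemma B.81 (Friedli–Velenik), box form.** An even set of `★`-edges with all endpoints in a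
coordinate box is a sum of `★`-triangles. Induction on `∑ⱼ (b j - a j)`: peel the top level of a
direction `i` with `a i < b i` (Phases 1 and 2), after which all endpoints lie in the smaller box
`b i ↦ b i - 1`; a box with no such direction carries no edge.
[cite: FriedliVelenik2017, App. B.15, Lemma B.81] -/
theorem inSpan_starTriangles_of_peelInv :
    ∀ (N : ℕ) (a b : Site d) (Z : Finset (Sym2 (Site d))), PeelInv a b Z →
      ∑ j, (b j - a j).toNat ≤ N → InSpan (starTriangles d) Z := by
  intro N
  induction N with
  | zero =>
    intro a b Z hZ hN
    -- no direction with `a i < b i`: the box is a point (or empty) and carries no `★`-edge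
    have hle : ∀ j, b j ≤ a j := fun j => by
      have := Finset.sum_eq_zero_iff.1 (Nat.le_zero.1 hN) j (Finset.mem_univ j); omega
    have hZ0 : Z = ∅ := by
      refine Finset.eq_empty_iff_forall_notMem.2 fun e he => ?_
      revert he
      induction e using Sym2.ind with
      | h x y =>
        intro he
        have hadj := hZ.edge _ he
        rw [SimpleGraph.mem_edgeSet] at hadj
        refine (zdStar_adj.1 hadj).1 (funext fun j => ?_)
        have hx := hZ.box _ he x (Sym2.mem_mk_left x y) j
        have hy := hZ.box _ he y (Sym2.mem_mk_right x y) j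
        have := hle j
        omega
    rw [hZ0]; exact InSpan.empty
  | succ N ih =>
    intro a b Z hZ hN
    by_cases hdir : ∃ i, a i < b i
    · obtain ⟨i, hab⟩ := hdir
      obtain ⟨Z₁, hZ₁, h0₁, hs₁⟩ := phase1 hab _ Z hZ rfl
      obtain ⟨Z₂, hZ₂, h0₂, hs₂⟩ := phase2 hab _ Z₁ hZ₁ h0₁ le_rfl
      -- `Z₂` lives in the smaller box
      set b' : Site d := Function.update b i (b i - 1) with hb'
      have hZ₂' : PeelInv a b' Z₂ := by
        refine ⟨hZ₂.edge, hZ₂.even, fun e he x hx j => ?_⟩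
        have hbx := hZ₂.box e he x hx j
        by_cases hj : j = i
        · subst hj
          rw [hb', Function.update_self]
          refine ⟨hbx.1, ?_⟩
          have hnt : ¬ Touch j (b j) e := fun ht => Finset.card_ne_zero.2 ⟨e, Finset.mem_filter.2 ⟨he, ht⟩⟩ h0₂
          have hxj : x j ≠ b j := by
            intro hxb
            apply hnt
            revert hx
            induction e using Sym2.ind with
            | h p q =>
              intro hx
              rw [touch_mk]
              rcases Sym2.mem_iff.1 hx with rfl | rfl
              · exact Or.inl hxb
              · exact Or.inr hxb
          omega
        · rw [hb', Function.update_of_ne hj]; exact hbx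
      refine hs₁ (hs₂ (ih a b' Z₂ hZ₂' ?_))
      -- the measure drops by one
      have hkey : ∀ j, (b' j - a j).toNat + (if j = i then 1 else 0) = (b j - a j).toNat := by
        intro j
        by_cases hj : j = i
        · subst hj; rw [if_pos rfl, hb', Function.update_self]; omega
        · rw [if_neg hj, hb', Function.update_of_ne hj]; omega
      have hsum : ∑ j, (b' j - a j).toNat + 1 = ∑ j, (b j - a j).toNat := by
        rw [← Finset.sum_congr rfl fun j _ => hkey j, Finset.sum_add_distrib, Finset.sum_ite_eq' Finset.univ i,
          if_pos (Finset.mem_univ i)]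
      omega
    · push Not at hdir
      refine ih a b Z hZ ?_
      rw [Finset.sum_eq_zero fun j _ => ?_]
      · exact Nat.zero_le _
      · have := hdir j; omega

/-- A finite set of pairs of lattice points lies in a coordinate cube `[-R, R]^d`. [folklore] -/
theorem exists_box_of_finset (Z : Finset (Sym2 (Site d))) :
    ∃ R : ℕ, ∀ e ∈ Z, ∀ x ∈ e, ∀ j, -(R : ℤ) ≤ x j ∧ x j ≤ R := by
  induction Z using Finset.induction_on with
  | empty => exact ⟨0, fun e he => absurd he (Finset.notMem_empty e)⟩
  | insert e s hes ih =>
    obtain ⟨R, hR⟩ := ih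
    revert hes
    induction e using Sym2.ind with
    | h x y =>
      intro hes
      refine ⟨max R (max (Finset.univ.sup fun j => (x j).natAbs) (Finset.univ.sup fun j => (y j).natAbs)),
        fun e he z hz j => ?_⟩
      rcases Finset.mem_insert.1 he with rfl | he
      · have hxj : (x j).natAbs ≤ Finset.univ.sup fun j => (x j).natAbs :=
          Finset.le_sup (f := fun j => (x j).natAbs) (Finset.mem_univ j)
        have hyj : (y j).natAbs ≤ Finset.univ.sup fun j => (y j).natAbs :=
          Finset.le_sup (f := fun j => (y j).natAbs) (Finset.mem_univ j)
        rcases Sym2.mem_iff.1 hz with rfl | rfl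
        · constructor <;> omega
        · constructor <;> omega
      · have := hR e he z hz j
        constructor <;> omega

/-- **Lemma B.81 (Friedli–Velenik 2017).** The `★`-triangles generate the cycle space of `ℤ^{d★}`:
every finite even set of `★`-edges is a sum modulo 2 of `★`-triangles.
[cite: FriedliVelenik2017, App. B.15, Lemma B.81] -/
theorem generatesCycles_zdStar (d : ℕ) : GeneratesCycles (zdStar d) (starTriangles d) := by
  intro Z hZ heven
  obtain ⟨R, hR⟩ := exists_box_of_finset Z
  exact inSpan_starTriangles_of_peelInv _ (fun _ => -(R : ℤ)) (fun _ => (R : ℤ)) Z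
    ⟨hZ, heven, fun e he x hx j => hR e he x hx j⟩
    le_rfl

end B81

end Literature.Probability.LatticeModels
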